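import Summits.QuantumFields.YangMills.Theorems.BalabanLadderNTMarkovMirrorResponseMomentsPackage
import Summits.QuantumFields.YangMills.Theorems.BalabanLadderUVSeamRecFloorsEngineOfBareMirror
import HarnessLib

/-!
# Crux `UVSeamRec` (stmt-QuantumFields-20043), stub `stub_floorsEngine` (S-B): CHECK-LEMMAS — the registered
# statement from {bare mirror floor, RESPONSE MOMENTS} at `rF`, no `∀`-exterior law

Helper file (`--supports stmt-QuantumFields-20043`) of the seam stub-prover row `ym-20043-seam-s1`; the
specialisation «last file» of `…NTMarkovMirrorResponseMomentsPackage` (general `(G, r, a)`) to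
`(SU(2), rF = fundamentalLatticeRep 2, a/uRec → c₀)`, parallel to p518416 `stubFloorsEngine_of_bareFloor_rF`
(currency {BL6, MF}) and p518416/p539458 (typical bare and pinned-affine currencies).

THE POINT (located, owner's pen; no registry content).  The v5(α) slot of record (afcf556d5b76a240) has two open
stubs: `stub_responseMomentsOdd6 : UV → (RM)` (measure side, feeding `stub_ceilings` through p532738
`TemperedResponse.stubCeilings_of_responseMoments`) and `stub_floorsEngine` (no `UV`).  The (S-B) residual of record
for the latter in Markov–mirror currency is {BL6, MF, clause (ii)} (R87 (1)), where BL6 is a `∀`-exterior femto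
boundary law — the species the lead's kit finding #50 leaves SUSPECT.  Here BL6 is replaced by the SINGLETON case
(RM₁) of the very law (RM) the slot already owes: `stubFloorsEngine_of_bareFloor_and_responseMoments_rF` takes

* `hRM` — the hypothesis of p532738 VERBATIM (`∃ a' c C₁ B β₁ ℓ₁ P₀ p, 0 < c ∧ (∀ᶠ β, a' β ≤ c·uRec β) ∧ 0 < ℓ₁ ∧
  0 < C₁ ∧ (|p| ≤ P₀) ∧ (RM at unit a')`), i.e. exactly the conclusion of `stub_responseMomentsOdd6 hUV`;
* `hF` — SCALABLE bare mirror floors at `rF`: a unit `a > 0` with `a β / uRec β → c₀ > 0`, and FOR EVERY femto range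
  `ℓ > 0` ONE compactly supported positive-time `v`, `ε > 0`, `κ > 0` and a positive-time cube family `Q_β` of
  physical size `≤ Λ₅` with `b_β·aβ ≤ ℓ`, carrying the lattice support of `v(aβ·)` at depth `≥ 2` and its
  `e₀`-thickening at physical depth `≥ κ`, with (MF) `9ε/4 ≤ Cov_T(Ṽ_v∘Θ₀, Ṽ_v)` on every torus `Λ₅ ≤ aβ·L`; plus any
  supplier of the compact-witness three-point conjunct;

and concludes the REGISTERED `stub_floorsEngine` statement verbatim.  (The femto range is universally quantified
because (RM)'s range `ℓ₁` and unit `a' ≤ c·uRec` are opened only inside the proof: `a' ≤ (2c/c₀)·a` eventually, so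
cubes with `b_β·aβ ≤ ℓ₁c₀/(2c)` are femto in the unit `a'`.)  `stubFloorsEngine_of_bareFloor_l2_responseMoments_rF` is
the parametric form (explicit `a', ℓ₁`, femto clause `b_β·a'β ≤ ℓ₁`, (RM₁) only); `rm1_of_rm` extracts (RM₁) from
(RM) (`n = 1`, `T = {0}`).  So a v5(α′) composition `UVSeamRec_of` could read the floors from
`stubFloorsEngine_of_bareFloor_and_responseMoments_rF (stub_responseMomentsOdd6 hUV) stub_floorsMF` with ONE non-fed
floors stub `stub_floorsMF := hF` = {scalable MF, clause (ii), unit clauses} — the owner's call.  Nothing here is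
`SU(2)`-specific beyond the instantiation.  Honest status: bookkeeping on a CONDITIONAL chain; (RM) is an OPEN RG
statement (E0′-K with background), MF (for each range `ℓ`, with `ε(ℓ) ≍ g(ℓ)⁴` expected) and clause (ii) are crux `NT`'s
open mathematics (barrier `PerturbativeInvisibility`); not a gap claim.
-/

set_option autoImplicit false

noncomputable section

open scoped SchwartzMap
open MeasureTheory Filter Topology
open Literature.MathematicalPhysics.QuantumFieldTheory Literature.MathematicalPhysics.QuantumLattice
open Literature.Probability.LatticeModels
open Summit.QuantumFields.YangMills.Cruxes.OSLegsFromFemtoAndGap.DlrCollarTransfer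
open Summit.QuantumFields.YangMills.Cruxes.NT.MarkovMirror

namespace Summit.QuantumFields.YangMills.Cruxes.UVSeamRec.MarkovMirrorFloors

section RM

variable (G : Type) [Group G] [TopologicalSpace G] [IsTopologicalGroup G] [CompactSpace G]
  [MeasurableSpace G] [BorelSpace G] (r : LatticeRep G)

/-- **(RM) ⇒ (RM₁).**  The joint exponential response-moment law (hypothesis of p532738, any `(G, r)`, unit `a'`)
specialised to ONE cube (`n = 1`, `T = {0}`; the cyclic-separation clause is vacuous). [folklore] -/
theorem rm1_of_rm {a' : ℝ → ℝ} {C₁ B β₁ ℓ₁ : ℝ} {p : Fin 4 × Fin 4 → ℝ → ℝ}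
    (hRM : ∀ β : ℝ, β₁ ≤ β → ∀ (L n : ℕ) (q : Fin n → Fin 4 × Fin 4) (x : Fin n → (Fin 4 → ℤ)) (R : ℕ),
      (∀ i, (q i).1 < (q i).2) → 1 ≤ R → (R : ℝ) * a' β ≤ ℓ₁ → 4 * R + 8 ≤ L →
      (∀ i j : Fin n, i ≠ j → ∃ k : Fin 4,
        (2 * (R : ℤ) + 4) ≤ |((((x i k - x j k : ℤ) : ZMod (2 * L + 1))).valMinAbs : ℤ)|) →
      ∀ T : Finset (Fin n),
        torusE G r β L (fun U => Real.exp (∑ i ∈ T, (R : ℝ) ^ 4 / C₁ *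
          |kerE G r β (fun k => x i k - (R + 1)) (2 * R + 3) U (plane G r (q i) (x i)) - p (q i) β|)) ≤
          Real.exp (B * T.card)) :
    ∀ β : ℝ, β₁ ≤ β → ∀ (L : ℕ) (q : Fin 4 × Fin 4) (x : Fin 4 → ℤ) (R : ℕ), q.1 < q.2 → 1 ≤ R →
      (R : ℝ) * a' β ≤ ℓ₁ → 4 * R + 8 ≤ L →
      torusE G r β L (fun U => Real.exp ((R : ℝ) ^ 4 / C₁ *
        |kerE G r β (fun k => x k - (R + 1)) (2 * R + 3) U (plane G r q x) - p q β|)) ≤ Real.exp B := by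
  intro β hβ L q x R hq hR hRa hRL
  have h := hRM β hβ L 1 (fun _ => q) (fun _ => x) R (fun _ => hq) hR hRa hRL
    (fun i j hij => absurd (Subsingleton.elim i j) hij) Finset.univ
  simp only [Finset.univ_unique, Finset.sum_singleton, Finset.card_singleton, Nat.cast_one, mul_one] at h
  exact h

/-- **Commensurability.**  If `a β / u β → c₀ > 0` (`u > 0`) and `a' β ≤ c·u β` eventually, then eventually
`a' β ≤ (2c/c₀)·a β` (for `c ≥ 0`). [folklore] -/
theorem eventually_le_mul_of_ratio {a a' u : ℝ → ℝ} {c₀ c : ℝ} (hc₀ : 0 < c₀) (hc : 0 ≤ c) (hu : ∀ β, 0 < u β)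
    (hau : Tendsto (fun β => a β / u β) atTop (𝓝 c₀)) (hle : ∀ᶠ β in atTop, a' β ≤ c * u β) :
    ∃ βu : ℝ, ∀ β, βu ≤ β → a' β ≤ 2 * c / c₀ * a β := by
  have h1 : ∀ᶠ β in atTop, c₀ / 2 ≤ a β / u β := hau.eventually (eventually_ge_nhds (by linarith))
  obtain ⟨βu, hβu⟩ := eventually_atTop.1 (h1.and hle)
  refine ⟨βu, fun β hβ => ?_⟩
  obtain ⟨hr, hl⟩ := hβu β hβ
  have huβ := hu β
  have hua : u β ≤ 2 / c₀ * a β := by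
    rw [le_div_iff₀ huβ] at hr
    rw [div_mul_eq_mul_div, le_div_iff₀ hc₀]
    linarith
  calc a' β ≤ c * u β := hl
    _ ≤ c * (2 / c₀ * a β) := mul_le_mul_of_nonneg_left hua hc
    _ = 2 * c / c₀ * a β := by ring

end RM

/-- **CHECK-LEMMA (parametric form): the REGISTERED `stub_floorsEngine` statement from {MF, RM₁} at `rF`.**  For
`SU(2)` with its Borel σ-algebra: (RM₁) at a unit `a'` (`C₁ > 0`, `B`, `β₁`, `ℓ₁ > 0`, reference values `p`); a unit
map `a > 0` with `a β / uRec β → c₀ > 0`; ONE compactly supported positive-time `v`, `ε > 0`, `κ > 0`; per coupling a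
positive-time cube `Q_β` of physical size `≤ Λ₅`, femto in the unit `a'` (`b_β·a'β ≤ ℓ₁`), carrying the lattice support
of `v(aβ·)` at depth `≥ 2` and its `e₀`-thickening at physical depth `≥ κ`; (MF) `9ε/4 ≤ Cov_T(Ṽ_v∘Θ₀, Ṽ_v)` on every
torus `aβ·L ≥ Λ₅`; any supplier of the three-point conjunct.  Then the statement of `stub_floorsEngine` holds
(`MarkovMirror.floorsTwoPoint_of_bareFloor_l2_responseMoments` at `rF`). [folklore] -/
theorem stubFloorsEngine_of_bareFloor_l2_responseMoments_rF (a' : ℝ → ℝ) {C₁ B β₁ ℓ₁ : ℝ} (hC₁ : 0 < C₁)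
    (hℓ₁ : 0 < ℓ₁) (p : Fin 4 × Fin 4 → ℝ → ℝ)
    (hRM : letI : MeasurableSpace (Matrix.specialUnitaryGroup (Fin 2) ℂ) := borel _
      haveI : BorelSpace (Matrix.specialUnitaryGroup (Fin 2) ℂ) := ⟨rfl⟩
      ∀ β : ℝ, β₁ ≤ β → ∀ (L : ℕ) (q : Fin 4 × Fin 4) (x : Fin 4 → ℤ) (R : ℕ), q.1 < q.2 → 1 ≤ R →
        (R : ℝ) * a' β ≤ ℓ₁ → 4 * R + 8 ≤ L →
        torusE (Matrix.specialUnitaryGroup (Fin 2) ℂ) (fundamentalLatticeRep 2) β L (fun U =>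
          Real.exp ((R : ℝ) ^ 4 / C₁ *
            |kerE (Matrix.specialUnitaryGroup (Fin 2) ℂ) (fundamentalLatticeRep 2) β (fun k => x k - (R + 1))
              (2 * R + 3) U (plane (Matrix.specialUnitaryGroup (Fin 2) ℂ) (fundamentalLatticeRep 2) q x) -
              p q β|)) ≤ Real.exp B)
    (h : letI : MeasurableSpace (Matrix.specialUnitaryGroup (Fin 2) ℂ) := borel _
      haveI : BorelSpace (Matrix.specialUnitaryGroup (Fin 2) ℂ) := ⟨rfl⟩
      ∃ (a : ℝ → ℝ) (c₀ : ℝ), 0 < c₀ ∧ (∀ β, 0 < a β) ∧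
        Tendsto (fun β => a β / Transport.uRec β) atTop (𝓝 c₀) ∧
      (∃ (v : 𝓢(EuclideanSpace ℝ (Fin 4), ℝ)) (ε β₅ Λ₅ κ : ℝ) (c : ℝ → (Fin 4 → ℤ)) (b : ℝ → ℕ),
          HasCompactSupport (v : EuclideanSpace ℝ (Fin 4) → ℝ) ∧
          tsupport (v : EuclideanSpace ℝ (Fin 4) → ℝ) ⊆ {y | 0 < y 0} ∧ 0 < ε ∧ 0 < κ ∧
          (∀ β, β₅ ≤ β → 1 ≤ c β 0 ∧ ∀ j : Fin 4, (|((c β j : ℤ) : ℝ)| + (b β : ℝ) + 3) * a β ≤ Λ₅) ∧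
          (∀ β, β₅ ≤ β → (b β : ℝ) * a' β ≤ ℓ₁) ∧
          (∀ β, β₅ ≤ β → ∀ x : Fin 4 → ℤ, v (a β • siteToE x) ≠ 0 →
            x ∈ cubeSites (c β) (b β) ∧ 2 ≤ depth (c β) (b β) x) ∧
          (∀ β, β₅ ≤ β → ∀ x : Fin 4 → ℤ,
            (v (a β • siteToE x) ≠ 0 ∨ v (a β • siteToE (x + Pi.single 0 1)) ≠ 0) →
              x ∈ cubeSites (c β) (b β) ∧ κ / a β ≤ (depth (c β) (b β) x : ℝ)) ∧
          (∀ β, β₅ ≤ β → ∀ L : ℕ, Λ₅ ≤ a β * L →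
            9 * ε / 4 ≤ torusE (Matrix.specialUnitaryGroup (Fin 2) ℂ) (fundamentalLatticeRep 2) β L (fun V =>
                (∑ y ∈ cubeSites (c β) (b β), v (a β • siteToE y) *
                    dens (Matrix.specialUnitaryGroup (Fin 2) ℂ) (fundamentalLatticeRep 2) y (cfgReflect V)) *
                  ∑ y ∈ cubeSites (c β) (b β), v (a β • siteToE y) *
                    dens (Matrix.specialUnitaryGroup (Fin 2) ℂ) (fundamentalLatticeRep 2) y V) -
              torusE (Matrix.specialUnitaryGroup (Fin 2) ℂ) (fundamentalLatticeRep 2) β L (fun V =>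
                  ∑ y ∈ cubeSites (c β) (b β), v (a β • siteToE y) *
                    dens (Matrix.specialUnitaryGroup (Fin 2) ℂ) (fundamentalLatticeRep 2) y (cfgReflect V)) *
                torusE (Matrix.specialUnitaryGroup (Fin 2) ℂ) (fundamentalLatticeRep 2) β L (fun V =>
                  ∑ y ∈ cubeSites (c β) (b β), v (a β • siteToE y) *
                    dens (Matrix.specialUnitaryGroup (Fin 2) ℂ) (fundamentalLatticeRep 2) y V))) ∧
      (∃ (f g h : 𝓢(EuclideanSpace ℝ (Fin 4), ℝ)) (ε β₅ Λ₅ : ℝ),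
        HasCompactSupport (f : EuclideanSpace ℝ (Fin 4) → ℝ) ∧
        HasCompactSupport (g : EuclideanSpace ℝ (Fin 4) → ℝ) ∧
        HasCompactSupport (h : EuclideanSpace ℝ (Fin 4) → ℝ) ∧
        Disjoint (tsupport (f : EuclideanSpace ℝ (Fin 4) → ℝ)) (tsupport (g : EuclideanSpace ℝ (Fin 4) → ℝ)) ∧
        Disjoint (tsupport (g : EuclideanSpace ℝ (Fin 4) → ℝ)) (tsupport (h : EuclideanSpace ℝ (Fin 4) → ℝ)) ∧
        Disjoint (tsupport (f : EuclideanSpace ℝ (Fin 4) → ℝ)) (tsupport (h : EuclideanSpace ℝ (Fin 4) → ℝ)) ∧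
        0 < ε ∧ ∀ β : ℝ, β₅ ≤ β → ∀ L : ℕ, Λ₅ ≤ a β * L →
          ε ≤ |Q3 (Matrix.specialUnitaryGroup (Fin 2) ℂ) (fundamentalLatticeRep 2) β L (a β) f g h|)) :
    letI : MeasurableSpace (Matrix.specialUnitaryGroup (Fin 2) ℂ) := borel _
    haveI : BorelSpace (Matrix.specialUnitaryGroup (Fin 2) ℂ) := ⟨rfl⟩
    ∃ (a : ℝ → ℝ) (c₀ : ℝ), 0 < c₀ ∧ (∀ β, 0 < a β) ∧
      Tendsto (fun β => a β / Transport.uRec β) atTop (𝓝 c₀) ∧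
      (∃ (v : 𝓢(EuclideanSpace ℝ (Fin 4), ℝ)) (ε β₅ Λ₅ : ℝ),
        HasCompactSupport (v : EuclideanSpace ℝ (Fin 4) → ℝ) ∧
        tsupport (v : EuclideanSpace ℝ (Fin 4) → ℝ) ⊆ {y : EuclideanSpace ℝ (Fin 4) | 0 < y 0} ∧ 0 < ε ∧
        ∀ β : ℝ, β₅ ≤ β → ∀ L : ℕ, Λ₅ ≤ a β * L →
          ε ≤ Q2 (Matrix.specialUnitaryGroup (Fin 2) ℂ) (fundamentalLatticeRep 2) β L (a β) (thetaTest 4 v) v) ∧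
      (∃ (f g h : 𝓢(EuclideanSpace ℝ (Fin 4), ℝ)) (ε β₅ Λ₅ : ℝ),
        HasCompactSupport (f : EuclideanSpace ℝ (Fin 4) → ℝ) ∧
        HasCompactSupport (g : EuclideanSpace ℝ (Fin 4) → ℝ) ∧
        HasCompactSupport (h : EuclideanSpace ℝ (Fin 4) → ℝ) ∧
        Disjoint (tsupport (f : EuclideanSpace ℝ (Fin 4) → ℝ)) (tsupport (g : EuclideanSpace ℝ (Fin 4) → ℝ)) ∧
        Disjoint (tsupport (g : EuclideanSpace ℝ (Fin 4) → ℝ)) (tsupport (h : EuclideanSpace ℝ (Fin 4) → ℝ)) ∧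
        Disjoint (tsupport (f : EuclideanSpace ℝ (Fin 4) → ℝ)) (tsupport (h : EuclideanSpace ℝ (Fin 4) → ℝ)) ∧
        0 < ε ∧ ∀ β : ℝ, β₅ ≤ β → ∀ L : ℕ, Λ₅ ≤ a β * L →
          ε ≤ |Q3 (Matrix.specialUnitaryGroup (Fin 2) ℂ) (fundamentalLatticeRep 2) β L (a β) f g h|) := by
  letI : MeasurableSpace (Matrix.specialUnitaryGroup (Fin 2) ℂ) := borel _
  haveI : BorelSpace (Matrix.specialUnitaryGroup (Fin 2) ℂ) := ⟨rfl⟩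
  obtain ⟨a, c₀, hc₀, ha₀, hau, ⟨v, ε, β₅, Λ₅, κ, c, b, hvK, hv, hε, hκ, hgeom, hfemto, hsupp, hthick, hMF⟩, h3⟩ := h
  have ha : Tendsto a atTop (𝓝 0) := ReferenceFloors.tendsto_zero_of_ratio hau
  exact ⟨a, c₀, hc₀, ha₀, hau,
    floorsTwoPoint_of_bareFloor_l2_responseMoments (Matrix.specialUnitaryGroup (Fin 2) ℂ) (fundamentalLatticeRep 2)
      a a' ha₀ ha v hvK hv hε hκ hC₁ hℓ₁ p c b hgeom hfemto hsupp hthick hRM hMF, h3⟩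

/-- **CHECK-LEMMA: the REGISTERED `stub_floorsEngine` statement from the verbatim (RM) hypothesis of p532738 and
SCALABLE bare mirror floors at `rF`.**  `hRM` is the hypothesis of `TemperedResponse.stubCeilings_of_responseMoments`
(the conclusion of the registered `stub_responseMomentsOdd6 hUV`) VERBATIM; `hF` = a unit `a > 0` with
`a β / uRec β → c₀ > 0`, and for EVERY range `ℓ > 0` a bare-mirror-floor package on a positive-time cube family with
`b_β·aβ ≤ ℓ` (module docstring), plus any supplier of the three-point conjunct.  Mechanism: open `hRM`
(`a' ≤ c·uRec` eventually, range `ℓ₁`), `eventually_le_mul_of_ratio` (`a' ≤ (2c/c₀)·a` eventually), take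
`ℓ := ℓ₁c₀/(2c)`, `rm1_of_rm`, and `stubFloorsEngine_of_bareFloor_l2_responseMoments_rF` on `β ≥ max β₅ βu`.
[folklore] -/
theorem stubFloorsEngine_of_bareFloor_and_responseMoments_rF
    (hRM : letI : MeasurableSpace (Matrix.specialUnitaryGroup (Fin 2) ℂ) := borel _
      haveI : BorelSpace (Matrix.specialUnitaryGroup (Fin 2) ℂ) := ⟨rfl⟩
      ∃ (a : ℝ → ℝ) (c : ℝ) (C₁ B β₁ ℓ₁ P₀ : ℝ) (p : Fin 4 × Fin 4 → ℝ → ℝ), 0 < c ∧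
        (∀ᶠ β in atTop, a β ≤ c * Transport.uRec β) ∧ 0 < ℓ₁ ∧ 0 < C₁ ∧ (∀ q β, |p q β| ≤ P₀) ∧
        ∀ β : ℝ, β₁ ≤ β → ∀ (L n : ℕ) (q : Fin n → Fin 4 × Fin 4) (x : Fin n → (Fin 4 → ℤ)) (R : ℕ),
          (∀ i, (q i).1 < (q i).2) → 1 ≤ R → (R : ℝ) * a β ≤ ℓ₁ → 4 * R + 8 ≤ L →
          (∀ i j : Fin n, i ≠ j → ∃ k : Fin 4,
            (2 * (R : ℤ) + 4) ≤ |((((x i k - x j k : ℤ) : ZMod (2 * L + 1))).valMinAbs : ℤ)|) →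
          ∀ T : Finset (Fin n),
            torusE (Matrix.specialUnitaryGroup (Fin 2) ℂ) (fundamentalLatticeRep 2) β L
              (fun U => Real.exp (∑ i ∈ T, (R : ℝ) ^ 4 / C₁ *
                |kerE (Matrix.specialUnitaryGroup (Fin 2) ℂ) (fundamentalLatticeRep 2) β
                  (fun k => x i k - (R + 1)) (2 * R + 3) U
                  (plane (Matrix.specialUnitaryGroup (Fin 2) ℂ) (fundamentalLatticeRep 2) (q i) (x i)) -
                  p (q i) β|)) ≤ Real.exp (B * T.card))
    (hF : letI : MeasurableSpace (Matrix.specialUnitaryGroup (Fin 2) ℂ) := borel _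
      haveI : BorelSpace (Matrix.specialUnitaryGroup (Fin 2) ℂ) := ⟨rfl⟩
      ∃ (a : ℝ → ℝ) (c₀ : ℝ), 0 < c₀ ∧ (∀ β, 0 < a β) ∧
        Tendsto (fun β => a β / Transport.uRec β) atTop (𝓝 c₀) ∧
      (∀ ℓ : ℝ, 0 < ℓ →
        ∃ (v : 𝓢(EuclideanSpace ℝ (Fin 4), ℝ)) (ε β₅ Λ₅ κ : ℝ) (c : ℝ → (Fin 4 → ℤ)) (b : ℝ → ℕ),
          HasCompactSupport (v : EuclideanSpace ℝ (Fin 4) → ℝ) ∧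
          tsupport (v : EuclideanSpace ℝ (Fin 4) → ℝ) ⊆ {y | 0 < y 0} ∧ 0 < ε ∧ 0 < κ ∧
          (∀ β, β₅ ≤ β → 1 ≤ c β 0 ∧ ∀ j : Fin 4, (|((c β j : ℤ) : ℝ)| + (b β : ℝ) + 3) * a β ≤ Λ₅) ∧
          (∀ β, β₅ ≤ β → (b β : ℝ) * a β ≤ ℓ) ∧
          (∀ β, β₅ ≤ β → ∀ x : Fin 4 → ℤ, v (a β • siteToE x) ≠ 0 →
            x ∈ cubeSites (c β) (b β) ∧ 2 ≤ depth (c β) (b β) x) ∧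
          (∀ β, β₅ ≤ β → ∀ x : Fin 4 → ℤ,
            (v (a β • siteToE x) ≠ 0 ∨ v (a β • siteToE (x + Pi.single 0 1)) ≠ 0) →
              x ∈ cubeSites (c β) (b β) ∧ κ / a β ≤ (depth (c β) (b β) x : ℝ)) ∧
          (∀ β, β₅ ≤ β → ∀ L : ℕ, Λ₅ ≤ a β * L →
            9 * ε / 4 ≤ torusE (Matrix.specialUnitaryGroup (Fin 2) ℂ) (fundamentalLatticeRep 2) β L (fun V =>
                (∑ y ∈ cubeSites (c β) (b β), v (a β • siteToE y) *
                    dens (Matrix.specialUnitaryGroup (Fin 2) ℂ) (fundamentalLatticeRep 2) y (cfgReflect V)) *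
                  ∑ y ∈ cubeSites (c β) (b β), v (a β • siteToE y) *
                    dens (Matrix.specialUnitaryGroup (Fin 2) ℂ) (fundamentalLatticeRep 2) y V) -
              torusE (Matrix.specialUnitaryGroup (Fin 2) ℂ) (fundamentalLatticeRep 2) β L (fun V =>
                  ∑ y ∈ cubeSites (c β) (b β), v (a β • siteToE y) *
                    dens (Matrix.specialUnitaryGroup (Fin 2) ℂ) (fundamentalLatticeRep 2) y (cfgReflect V)) *
                torusE (Matrix.specialUnitaryGroup (Fin 2) ℂ) (fundamentalLatticeRep 2) β L (fun V =>
                  ∑ y ∈ cubeSites (c β) (b β), v (a β • siteToE y) *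
                    dens (Matrix.specialUnitaryGroup (Fin 2) ℂ) (fundamentalLatticeRep 2) y V))) ∧
      (∃ (f g h : 𝓢(EuclideanSpace ℝ (Fin 4), ℝ)) (ε β₅ Λ₅ : ℝ),
        HasCompactSupport (f : EuclideanSpace ℝ (Fin 4) → ℝ) ∧
        HasCompactSupport (g : EuclideanSpace ℝ (Fin 4) → ℝ) ∧
        HasCompactSupport (h : EuclideanSpace ℝ (Fin 4) → ℝ) ∧
        Disjoint (tsupport (f : EuclideanSpace ℝ (Fin 4) → ℝ)) (tsupport (g : EuclideanSpace ℝ (Fin 4) → ℝ)) ∧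
        Disjoint (tsupport (g : EuclideanSpace ℝ (Fin 4) → ℝ)) (tsupport (h : EuclideanSpace ℝ (Fin 4) → ℝ)) ∧
        Disjoint (tsupport (f : EuclideanSpace ℝ (Fin 4) → ℝ)) (tsupport (h : EuclideanSpace ℝ (Fin 4) → ℝ)) ∧
        0 < ε ∧ ∀ β : ℝ, β₅ ≤ β → ∀ L : ℕ, Λ₅ ≤ a β * L →
          ε ≤ |Q3 (Matrix.specialUnitaryGroup (Fin 2) ℂ) (fundamentalLatticeRep 2) β L (a β) f g h|)) :
    letI : MeasurableSpace (Matrix.specialUnitaryGroup (Fin 2) ℂ) := borel _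
    haveI : BorelSpace (Matrix.specialUnitaryGroup (Fin 2) ℂ) := ⟨rfl⟩
    ∃ (a : ℝ → ℝ) (c₀ : ℝ), 0 < c₀ ∧ (∀ β, 0 < a β) ∧
      Tendsto (fun β => a β / Transport.uRec β) atTop (𝓝 c₀) ∧
      (∃ (v : 𝓢(EuclideanSpace ℝ (Fin 4), ℝ)) (ε β₅ Λ₅ : ℝ),
        HasCompactSupport (v : EuclideanSpace ℝ (Fin 4) → ℝ) ∧
        tsupport (v : EuclideanSpace ℝ (Fin 4) → ℝ) ⊆ {y : EuclideanSpace ℝ (Fin 4) | 0 < y 0} ∧ 0 < ε ∧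
        ∀ β : ℝ, β₅ ≤ β → ∀ L : ℕ, Λ₅ ≤ a β * L →
          ε ≤ Q2 (Matrix.specialUnitaryGroup (Fin 2) ℂ) (fundamentalLatticeRep 2) β L (a β) (thetaTest 4 v) v) ∧
      (∃ (f g h : 𝓢(EuclideanSpace ℝ (Fin 4), ℝ)) (ε β₅ Λ₅ : ℝ),
        HasCompactSupport (f : EuclideanSpace ℝ (Fin 4) → ℝ) ∧
        HasCompactSupport (g : EuclideanSpace ℝ (Fin 4) → ℝ) ∧
        HasCompactSupport (h : EuclideanSpace ℝ (Fin 4) → ℝ) ∧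
        Disjoint (tsupport (f : EuclideanSpace ℝ (Fin 4) → ℝ)) (tsupport (g : EuclideanSpace ℝ (Fin 4) → ℝ)) ∧
        Disjoint (tsupport (g : EuclideanSpace ℝ (Fin 4) → ℝ)) (tsupport (h : EuclideanSpace ℝ (Fin 4) → ℝ)) ∧
        Disjoint (tsupport (f : EuclideanSpace ℝ (Fin 4) → ℝ)) (tsupport (h : EuclideanSpace ℝ (Fin 4) → ℝ)) ∧
        0 < ε ∧ ∀ β : ℝ, β₅ ≤ β → ∀ L : ℕ, Λ₅ ≤ a β * L →
          ε ≤ |Q3 (Matrix.specialUnitaryGroup (Fin 2) ℂ) (fundamentalLatticeRep 2) β L (a β) f g h|) := by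
  letI : MeasurableSpace (Matrix.specialUnitaryGroup (Fin 2) ℂ) := borel _
  haveI : BorelSpace (Matrix.specialUnitaryGroup (Fin 2) ℂ) := ⟨rfl⟩
  obtain ⟨a', cc, C₁, B, β₁, ℓ₁, P₀, p, hcc, hle, hℓ₁, hC₁, -, hRMb⟩ := hRM
  obtain ⟨a, c₀, hc₀, ha₀, hau, hscal, h3⟩ := hF
  -- the unit of (RM) is eventually below a multiple of the floors' unit
  obtain ⟨βu, hβu⟩ := eventually_le_mul_of_ratio hc₀ hcc.le UnitTransfer.uRec_pos hau hle
  -- the femto range in the floors' unit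
  have hℓ : 0 < ℓ₁ * c₀ / (2 * cc) := by positivity
  obtain ⟨v, ε, β₅, Λ₅, κ, c, b, hvK, hv, hε, hκ, hgeom, hsize, hsupp, hthick, hMF⟩ := hscal _ hℓ
  -- femto-commensurability on `β ≥ max β₅ βu`
  have hfemto : ∀ β, max β₅ βu ≤ β → (b β : ℝ) * a' β ≤ ℓ₁ := by
    intro β hβ
    have hβ₅ : β₅ ≤ β := le_trans (le_max_left _ _) hβ
    have h1 := hβu β (le_trans (le_max_right _ _) hβ)
    have h2 := hsize β hβ₅
    have hb0 : (0 : ℝ) ≤ b β := Nat.cast_nonneg _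
    calc (b β : ℝ) * a' β ≤ (b β : ℝ) * (2 * cc / c₀ * a β) := mul_le_mul_of_nonneg_left h1 hb0
      _ = 2 * cc / c₀ * ((b β : ℝ) * a β) := by ring
      _ ≤ 2 * cc / c₀ * (ℓ₁ * c₀ / (2 * cc)) := mul_le_mul_of_nonneg_left h2 (by positivity)
      _ = ℓ₁ := by field_simp
  exact stubFloorsEngine_of_bareFloor_l2_responseMoments_rF a' hC₁ hℓ₁ p
    (rm1_of_rm (Matrix.specialUnitaryGroup (Fin 2) ℂ) (fundamentalLatticeRep 2) hRMb)
    ⟨a, c₀, hc₀, ha₀, hau, ⟨v, ε, max β₅ βu, Λ₅, κ, c, b, hvK, hv, hε, hκ,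
      fun β hβ => hgeom β (le_trans (le_max_left _ _) hβ), hfemto,
      fun β hβ => hsupp β (le_trans (le_max_left _ _) hβ),
      fun β hβ => hthick β (le_trans (le_max_left _ _) hβ),
      fun β hβ => hMF β (le_trans (le_max_left _ _) hβ)⟩, h3⟩


/-- **CHECK-LEMMA (weakest composable form): the REGISTERED `stub_floorsEngine` statement from the verbatim (RM)
hypothesis of p532738 and bare mirror floors FEMTO IN THE (RM) UNIT.**  As
`stubFloorsEngine_of_bareFloor_and_responseMoments_rF`, but the floors hypothesis is allowed to SEE the unit data of
(RM): for every unit `a'`, constant `c > 0` and range `ℓ₁ > 0` with `a' β ≤ c·uRec β` eventually, a floors package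
{unit `a > 0`, `a β / uRec β → c₀ > 0`; ONE `v`, `ε`, `κ`, a positive-time cube family of physical size `≤ Λ₅` with
the femto clause `b_β·a'β ≤ ℓ₁`, support / thickening conditions, MF(9ε/4) on the tori `Λ₅ ≤ aβ·L`; the three-point
conjunct}.  This is implied by the scalable form (take `ℓ := ℓ₁c₀/(2c)`, `eventually_le_mul_of_ratio`) and asks MF at
ONE scale per admissible `(a', c, ℓ₁)` only. [folklore] -/
theorem stubFloorsEngine_of_bareFloorFemto_and_responseMoments_rF
    (hRM : letI : MeasurableSpace (Matrix.specialUnitaryGroup (Fin 2) ℂ) := borel _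
      haveI : BorelSpace (Matrix.specialUnitaryGroup (Fin 2) ℂ) := ⟨rfl⟩
      ∃ (a : ℝ → ℝ) (c : ℝ) (C₁ B β₁ ℓ₁ P₀ : ℝ) (p : Fin 4 × Fin 4 → ℝ → ℝ), 0 < c ∧
        (∀ᶠ β in atTop, a β ≤ c * Transport.uRec β) ∧ 0 < ℓ₁ ∧ 0 < C₁ ∧ (∀ q β, |p q β| ≤ P₀) ∧
        ∀ β : ℝ, β₁ ≤ β → ∀ (L n : ℕ) (q : Fin n → Fin 4 × Fin 4) (x : Fin n → (Fin 4 → ℤ)) (R : ℕ),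
          (∀ i, (q i).1 < (q i).2) → 1 ≤ R → (R : ℝ) * a β ≤ ℓ₁ → 4 * R + 8 ≤ L →
          (∀ i j : Fin n, i ≠ j → ∃ k : Fin 4,
            (2 * (R : ℤ) + 4) ≤ |((((x i k - x j k : ℤ) : ZMod (2 * L + 1))).valMinAbs : ℤ)|) →
          ∀ T : Finset (Fin n),
            torusE (Matrix.specialUnitaryGroup (Fin 2) ℂ) (fundamentalLatticeRep 2) β L
              (fun U => Real.exp (∑ i ∈ T, (R : ℝ) ^ 4 / C₁ *
                |kerE (Matrix.specialUnitaryGroup (Fin 2) ℂ) (fundamentalLatticeRep 2) β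
                  (fun k => x i k - (R + 1)) (2 * R + 3) U
                  (plane (Matrix.specialUnitaryGroup (Fin 2) ℂ) (fundamentalLatticeRep 2) (q i) (x i)) -
                  p (q i) β|)) ≤ Real.exp (B * T.card))
    (hF : letI : MeasurableSpace (Matrix.specialUnitaryGroup (Fin 2) ℂ) := borel _
      haveI : BorelSpace (Matrix.specialUnitaryGroup (Fin 2) ℂ) := ⟨rfl⟩
      ∀ (a' : ℝ → ℝ) (c ℓ₁ : ℝ), 0 < c → 0 < ℓ₁ → (∀ᶠ β in atTop, a' β ≤ c * Transport.uRec β) →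
      ∃ (a : ℝ → ℝ) (c₀ : ℝ), 0 < c₀ ∧ (∀ β, 0 < a β) ∧
        Tendsto (fun β => a β / Transport.uRec β) atTop (𝓝 c₀) ∧
      (∃ (v : 𝓢(EuclideanSpace ℝ (Fin 4), ℝ)) (ε β₅ Λ₅ κ : ℝ) (c : ℝ → (Fin 4 → ℤ)) (b : ℝ → ℕ),
          HasCompactSupport (v : EuclideanSpace ℝ (Fin 4) → ℝ) ∧
          tsupport (v : EuclideanSpace ℝ (Fin 4) → ℝ) ⊆ {y | 0 < y 0} ∧ 0 < ε ∧ 0 < κ ∧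
          (∀ β, β₅ ≤ β → 1 ≤ c β 0 ∧ ∀ j : Fin 4, (|((c β j : ℤ) : ℝ)| + (b β : ℝ) + 3) * a β ≤ Λ₅) ∧
          (∀ β, β₅ ≤ β → (b β : ℝ) * a' β ≤ ℓ₁) ∧
          (∀ β, β₅ ≤ β → ∀ x : Fin 4 → ℤ, v (a β • siteToE x) ≠ 0 →
            x ∈ cubeSites (c β) (b β) ∧ 2 ≤ depth (c β) (b β) x) ∧
          (∀ β, β₅ ≤ β → ∀ x : Fin 4 → ℤ,
            (v (a β • siteToE x) ≠ 0 ∨ v (a β • siteToE (x + Pi.single 0 1)) ≠ 0) →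
              x ∈ cubeSites (c β) (b β) ∧ κ / a β ≤ (depth (c β) (b β) x : ℝ)) ∧
          (∀ β, β₅ ≤ β → ∀ L : ℕ, Λ₅ ≤ a β * L →
            9 * ε / 4 ≤ torusE (Matrix.specialUnitaryGroup (Fin 2) ℂ) (fundamentalLatticeRep 2) β L (fun V =>
                (∑ y ∈ cubeSites (c β) (b β), v (a β • siteToE y) *
                    dens (Matrix.specialUnitaryGroup (Fin 2) ℂ) (fundamentalLatticeRep 2) y (cfgReflect V)) *
                  ∑ y ∈ cubeSites (c β) (b β), v (a β • siteToE y) *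
                    dens (Matrix.specialUnitaryGroup (Fin 2) ℂ) (fundamentalLatticeRep 2) y V) -
              torusE (Matrix.specialUnitaryGroup (Fin 2) ℂ) (fundamentalLatticeRep 2) β L (fun V =>
                  ∑ y ∈ cubeSites (c β) (b β), v (a β • siteToE y) *
                    dens (Matrix.specialUnitaryGroup (Fin 2) ℂ) (fundamentalLatticeRep 2) y (cfgReflect V)) *
                torusE (Matrix.specialUnitaryGroup (Fin 2) ℂ) (fundamentalLatticeRep 2) β L (fun V =>
                  ∑ y ∈ cubeSites (c β) (b β), v (a β • siteToE y) *
                    dens (Matrix.specialUnitaryGroup (Fin 2) ℂ) (fundamentalLatticeRep 2) y V))) ∧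
      (∃ (f g h : 𝓢(EuclideanSpace ℝ (Fin 4), ℝ)) (ε β₅ Λ₅ : ℝ),
        HasCompactSupport (f : EuclideanSpace ℝ (Fin 4) → ℝ) ∧
        HasCompactSupport (g : EuclideanSpace ℝ (Fin 4) → ℝ) ∧
        HasCompactSupport (h : EuclideanSpace ℝ (Fin 4) → ℝ) ∧
        Disjoint (tsupport (f : EuclideanSpace ℝ (Fin 4) → ℝ)) (tsupport (g : EuclideanSpace ℝ (Fin 4) → ℝ)) ∧
        Disjoint (tsupport (g : EuclideanSpace ℝ (Fin 4) → ℝ)) (tsupport (h : EuclideanSpace ℝ (Fin 4) → ℝ)) ∧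
        Disjoint (tsupport (f : EuclideanSpace ℝ (Fin 4) → ℝ)) (tsupport (h : EuclideanSpace ℝ (Fin 4) → ℝ)) ∧
        0 < ε ∧ ∀ β : ℝ, β₅ ≤ β → ∀ L : ℕ, Λ₅ ≤ a β * L →
          ε ≤ |Q3 (Matrix.specialUnitaryGroup (Fin 2) ℂ) (fundamentalLatticeRep 2) β L (a β) f g h|)) :
    letI : MeasurableSpace (Matrix.specialUnitaryGroup (Fin 2) ℂ) := borel _
    haveI : BorelSpace (Matrix.specialUnitaryGroup (Fin 2) ℂ) := ⟨rfl⟩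
    ∃ (a : ℝ → ℝ) (c₀ : ℝ), 0 < c₀ ∧ (∀ β, 0 < a β) ∧
      Tendsto (fun β => a β / Transport.uRec β) atTop (𝓝 c₀) ∧
      (∃ (v : 𝓢(EuclideanSpace ℝ (Fin 4), ℝ)) (ε β₅ Λ₅ : ℝ),
        HasCompactSupport (v : EuclideanSpace ℝ (Fin 4) → ℝ) ∧
        tsupport (v : EuclideanSpace ℝ (Fin 4) → ℝ) ⊆ {y : EuclideanSpace ℝ (Fin 4) | 0 < y 0} ∧ 0 < ε ∧
        ∀ β : ℝ, β₅ ≤ β → ∀ L : ℕ, Λ₅ ≤ a β * L →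
          ε ≤ Q2 (Matrix.specialUnitaryGroup (Fin 2) ℂ) (fundamentalLatticeRep 2) β L (a β) (thetaTest 4 v) v) ∧
      (∃ (f g h : 𝓢(EuclideanSpace ℝ (Fin 4), ℝ)) (ε β₅ Λ₅ : ℝ),
        HasCompactSupport (f : EuclideanSpace ℝ (Fin 4) → ℝ) ∧
        HasCompactSupport (g : EuclideanSpace ℝ (Fin 4) → ℝ) ∧
        HasCompactSupport (h : EuclideanSpace ℝ (Fin 4) → ℝ) ∧
        Disjoint (tsupport (f : EuclideanSpace ℝ (Fin 4) → ℝ)) (tsupport (g : EuclideanSpace ℝ (Fin 4) → ℝ)) ∧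
        Disjoint (tsupport (g : EuclideanSpace ℝ (Fin 4) → ℝ)) (tsupport (h : EuclideanSpace ℝ (Fin 4) → ℝ)) ∧
        Disjoint (tsupport (f : EuclideanSpace ℝ (Fin 4) → ℝ)) (tsupport (h : EuclideanSpace ℝ (Fin 4) → ℝ)) ∧
        0 < ε ∧ ∀ β : ℝ, β₅ ≤ β → ∀ L : ℕ, Λ₅ ≤ a β * L →
          ε ≤ |Q3 (Matrix.specialUnitaryGroup (Fin 2) ℂ) (fundamentalLatticeRep 2) β L (a β) f g h|) := by
  letI : MeasurableSpace (Matrix.specialUnitaryGroup (Fin 2) ℂ) := borel _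
  haveI : BorelSpace (Matrix.specialUnitaryGroup (Fin 2) ℂ) := ⟨rfl⟩
  obtain ⟨a', cc, C₁, B, β₁, ℓ₁, P₀, p, hcc, hle, hℓ₁, hC₁, -, hRMb⟩ := hRM
  exact stubFloorsEngine_of_bareFloor_l2_responseMoments_rF a' hC₁ hℓ₁ p
    (rm1_of_rm (Matrix.specialUnitaryGroup (Fin 2) ℂ) (fundamentalLatticeRep 2) hRMb) (hF a' cc ℓ₁ hcc hℓ₁ hle)

end Summit.QuantumFields.YangMills.Cruxes.UVSeamRec.MarkovMirrorFloors

end
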